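import Mathlib.Analysis.Asymptotics.SuperpolynomialDecay
import Mathlib.Analysis.InnerProductSpace.Projection.Basic
import Literature.MathematicalPhysics.QuantumLattice.FinDimSpectrum
import Literature.MathematicalPhysics.QuantumLattice.SpinSystem
import Literature.MathematicalPhysics.QuantumLattice.LatticeTori
import Literature.MathematicalPhysics.QuantumLattice.LocalDynamics
import Literature.Probability.LatticeModels.LatticeGraph
import HarnessLib

-- provenance: harness21/H21/H21/Prelude/QLatticeAQFT/LTQO.lean @ 882c699 (interim HEAD d8f2665); M5 mechanical rewrite
/-!
# Local topological quantum order (trunk QLatticeAQFT, item Q11 `LTQO`)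

Notion `ltqo_frustration_free`. The vocabulary consumed by the Michalakis–Zwolak stability theorem
(hubbard.S19) for frustration-free Hamiltonians on periodic boxes.

Setting (outline Q-D6, Q-D7): the sites are `StatMech.TorusSite d L × κ`, the cubic discrete torus
`(ℤ/Lℤ)^d` decorated with a finite *unit cell* `κ` (`[Fintype κ] [DecidableEq κ]`; Bravais lattices
`κ = Unit`, kagome `κ = Fin 3`), the local dimension is `q`, and `Φ : Interaction (TorusSite d L × κ) q`
is a (projector, local) interaction in the sense of `Literature.Prelude.QLatticeAQFT.LocalDynamics`. Balls
are the sup-norm torus balls of `LatticeTori` times the whole unit cell, `cellBall x r =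
torusBall x r ×ˢ univ`.

Contents:

* `localGroundSpace Φ B = ⋂_{X ⊆ B} ker Φ X`, the common kernel of the terms inside `B` (for a
  frustration-free projector interaction this is the ground space of `H_B = Σ_{X ⊆ B} Φ X`, of
  energy `0`); `localGroundProj Φ B = P_B`, its orthogonal projection as a matrix (via
  `Literature.MathematicalPhysics.QuantumLattice.projMatrix`, i.e. Mathlib's `Submodule.starProjection`);
* `ltqoConst P O = tr (P O) / tr P`, the scalar `c(O)` of Michalakis–Zwolak;
* **LTQO** (Michalakis–Zwolak, Definition 2): `HasLTQO Φ Δ` says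
  `‖P_{B(x, r+ℓ)} O P_{B(x, r+ℓ)} - c(O) P_{B(x, r+ℓ)}‖ ≤ ‖O‖ Δ(ℓ)` for every observable `O`
  supported in `B(x, r)` whenever `2 (r + ℓ) < L` (the ball does not wrap around the torus);
  `HasUniformLTQO` is the version for a family of interactions indexed by the side `L`, with one
  rate `Δ`; `IsDecaying Δ` (`Δ ℓ → 0`) and `HasFastDecay Δ` (Mathlib's
  `Asymptotics.SuperpolynomialDecay`) are the decay classes of the rate;
* **local gap** (Michalakis–Zwolak, Definition 3): `HasLocalGap Φ γ` says that every local
  Hamiltonian `H_{B(x, r)}` has the cluster gap `Matrix.HasClusterGap _ m 0 (γ r)` above its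
  `m = dim localGroundSpace`-fold degenerate ground cluster of width `0` (outline Q-D4);
* API: `localGroundProj_isHermitian`, `localGroundProj_idempotent` (real, from `projMatrix`),
  `localGroundSpace_antitone`, `HasLTQO.mono`.

## Sources

* S. Michalakis, J. P. Zwolak, *Stability of frustration-free Hamiltonians*, Comm. Math. Phys.
  **322** (2013) 277–302, §2, Definitions 1–3 and Theorem 1 ("MZ13").
* S. Bravyi, M. B. Hastings, S. Michalakis, *Topological quantum order: stability under local
  perturbations*, J. Math. Phys. **51** (2010) 093512, §2 (TQO-1/TQO-2, the origin of LTQO;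
  "BHM10").
* S. Bravyi, M. B. Hastings, *A short proof of stability of topological order under local
  perturbations*, Comm. Math. Phys. **307** (2011) 609.

## Mathlib / design notes

* Mathlib search: `Submodule.starProjection`, `LinearMap.ker`, `Matrix.toLin'`, `Matrix.trace`,
  `Module.finrank`, `Filter.Tendsto`, `Asymptotics.SuperpolynomialDecay` are used; Mathlib has no
  topological-order / LTQO / local-gap vocabulary (`rg -i "topological order|ltqo|frustration"`
  finds nothing), and orthogonal projections as matrices come from `Literature.MathematicalPhysics.QuantumLattice.projMatrix`
  (item Q1).
* `localGroundSpace`, `localGroundProj`, `ltqoConst` are stated for an arbitrary finite site set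
  `Λ` (resp. index type `n`); only the LTQO / local-gap predicates specialise to decorated tori.
  `localGroundProj` follows the pattern of `Matrix.groundProj`: the submodule of `TensorIndex Λ q → ℂ`
  is moved to `EuclideanSpace ℂ _` along `WithLp.linearEquiv` before projecting.
* The centre of a ball is a Bravais site `x : TorusSite d L` (not a decorated site): balls are
  unions of whole unit cells, as in MZ13 §2 (coarse-grained lattice).
* MZ13 allow the local gap `γ(ℓ)` to decay polynomially in the radius; accordingly `HasLocalGap`
  takes a rate `γ : ℕ → ℝ` (radius ↦ gap); the uniform local gap of the outline is `fun _ => γ₀`.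
* The side condition `2 (r + ℓ) < L` in `HasLTQO` replaces MZ13's "`r + ℓ ≤ L*`": it guarantees that
  the ball `B(x, r + ℓ)` is a genuine cube not wrapping around the torus.
* Junk values: `ltqoConst P O = 0` when `tr P = 0` (`x / 0 = 0`), i.e. when the local ground space
  is trivial; then the LTQO inequality reads `‖0‖ ≤ ‖O‖ Δ ℓ`, harmless under `0 ≤ Δ`.
-/

noncomputable section

open Matrix Complex Finset Filter
open scoped Matrix.Norms.L2Operator Topology

namespace Literature.MathematicalPhysics.QuantumLattice

open Literature.Probability.LatticeModels

/-! ### Local ground spaces and their projections -/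

section General

variable {Λ : Type*} [Fintype Λ] [DecidableEq Λ] {q : ℕ}

/-- The *local ground space* of the interaction `Φ` in the region `B`: the common kernel
`⋂_{X ⊆ B} ker (Φ X)` of all terms inside `B`, as a submodule of `TensorIndex Λ q → ℂ`
(`Matrix.toLin'`). For a frustration-free projector interaction this is the (energy-`0`) ground
space of the local Hamiltonian `H_B = Σ_{X ⊆ B} Φ X`. MZ13 §2 (the projection `P_B`); BHM10 §2.
[folklore] -/
def localGroundSpace (Φ : Interaction Λ q) (B : Finset Λ) : Submodule ℂ (TensorIndex Λ q → ℂ) :=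
  ⨅ X ∈ B.powerset, LinearMap.ker (Matrix.toLin' (Φ X))

/-- Membership in the local ground space: `ψ` is annihilated by every term inside `B`.
MZ13 §2. [folklore] -/
theorem mem_localGroundSpace_iff (Φ : Interaction Λ q) (B : Finset Λ) (ψ : TensorIndex Λ q → ℂ) :
    ψ ∈ localGroundSpace Φ B ↔ ∀ X, X ⊆ B → Φ X *ᵥ ψ = 0 := by
  simp [localGroundSpace, Submodule.mem_iInf]

/-- The local ground spaces are antitone in the region: enlarging `B` adds constraints,
`B ⊆ B' → localGroundSpace Φ B' ≤ localGroundSpace Φ B`. MZ13 §2 (`P_{B'} ≤ P_B`). [folklore] -/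
theorem localGroundSpace_antitone (Φ : Interaction Λ q) : Antitone (localGroundSpace Φ) := by
  intro B B' h
  simp only [localGroundSpace, le_iInf_iff]
  exact fun X hX => iInf₂_le X (mem_powerset.2 ((mem_powerset.1 hX).trans h))

/-- The *local ground-state projection* `P_B`: the orthogonal projection onto
`localGroundSpace Φ B`, as a matrix in `𝔄_Λ` (`projMatrix`, i.e. Mathlib's
`Submodule.starProjection`, of the local ground space moved to `EuclideanSpace ℂ _` along
`WithLp.linearEquiv`, exactly as `Matrix.groundProj`). MZ13 §2, Definition 2; BHM10 §2.
[folklore] -/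
def localGroundProj (Φ : Interaction Λ q) (B : Finset Λ) : Op Λ q :=
  projMatrix ((localGroundSpace Φ B).map
    ((WithLp.linearEquiv 2 ℂ (TensorIndex Λ q → ℂ)).symm :
      (TensorIndex Λ q → ℂ) →ₗ[ℂ] EuclideanSpace ℂ (TensorIndex Λ q)))

/-- `P_B` is Hermitian (`projMatrix_isHermitian`). MZ13 §2. [folklore] -/
theorem localGroundProj_isHermitian (Φ : Interaction Λ q) (B : Finset Λ) :
    (localGroundProj Φ B).IsHermitian :=
  projMatrix_isHermitian _

/-- `P_B` is idempotent, `P_B² = P_B` (`projMatrix_mul_self`). MZ13 §2. [folklore] -/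
theorem localGroundProj_idempotent (Φ : Interaction Λ q) (B : Finset Λ) :
    IsIdempotentElem (localGroundProj Φ B) :=
  projMatrix_mul_self _

/-- For a local interaction, `P_B` is supported on `B` (the terms `Φ X`, `X ⊆ B`, act only on the
tensor factors in `B`). MZ13 §2 (elementary; recorded as a named fact).
[cite: MichalakisZwolakCMP2013, §2] -/
def localGroundProj_isSupportedOn : Prop :=
  ∀ {Φ : Interaction Λ q} (h : Φ.IsLocal) (B : Finset Λ),
    IsSupportedOn (localGroundProj Φ B) B

/-- `P_{B'} P_B = P_{B'}` for `B ⊆ B'` (the ground spaces are nested,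
`localGroundSpace_antitone`). MZ13 §2 (elementary; recorded as a named fact).
[cite: MichalakisZwolakCMP2013, §2] -/
def localGroundProj_mul_of_subset : Prop :=
  ∀ (Φ : Interaction Λ q) {B B' : Finset Λ} (h : B ⊆ B'),
    localGroundProj Φ B' * localGroundProj Φ B = localGroundProj Φ B'

end General

/-! ### The LTQO constant -/

section Const

variable {n : Type*} [Fintype n]

/-- The scalar `c(O) = tr (P O) / tr P` of Michalakis–Zwolak: the expectation of `O` in the
uniform mixture on the range of the projection `P`. **Junk value** `0` when `tr P = 0`.
MZ13 §2, Definition 2; BHM10 §2 (TQO-2). [folklore] -/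
def ltqoConst (P O : Matrix n n ℂ) : ℂ :=
  (P * O).trace / P.trace

/-- `c(P) = 1` for a nonzero-trace idempotent `P`. MZ13 §2. [folklore] -/
theorem ltqoConst_self {P : Matrix n n ℂ} (hP : IsIdempotentElem P) (h0 : P.trace ≠ 0) :
    ltqoConst P P = 1 := by
  rw [ltqoConst, hP.eq, div_self h0]

/-- `c(1) = 1` when `tr P ≠ 0`. MZ13 §2. [folklore] -/
theorem ltqoConst_one [DecidableEq n] {P : Matrix n n ℂ} (h0 : P.trace ≠ 0) :
    ltqoConst P 1 = 1 := by
  rw [ltqoConst, mul_one, div_self h0]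

end Const

/-! ### Decay classes of rate functions -/

/-- A rate function `Δ : ℕ → ℝ` *decays*: `Δ ℓ → 0` as `ℓ → ∞` (Mathlib's `Filter.Tendsto`).
MZ13 §2, Definition 2 ("`Δ(ℓ)` a decaying function"). [folklore] -/
def IsDecaying (Δ : ℕ → ℝ) : Prop :=
  Tendsto Δ atTop (𝓝 0)

/-- A rate function `Δ : ℕ → ℝ` has *fast (superpolynomial) decay*: `ℓ^k Δ ℓ → 0` for every `k`
(Mathlib's `Asymptotics.SuperpolynomialDecay` along `atTop` with parameter `ℓ ↦ (ℓ : ℝ)`).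
MZ13 §2, Theorem 1 ("`Δ(ℓ)` decays faster than any polynomial"). [folklore] -/
def HasFastDecay (Δ : ℕ → ℝ) : Prop :=
  Asymptotics.SuperpolynomialDecay atTop (fun ℓ : ℕ => (ℓ : ℝ)) Δ

/-- Fast decay implies decay (the case `k = 0` of `SuperpolynomialDecay`). MZ13 §2. [folklore] -/
theorem HasFastDecay.isDecaying {Δ : ℕ → ℝ} (h : HasFastDecay Δ) : IsDecaying Δ := by
  simpa [IsDecaying] using h 0

/-! ### LTQO and the local gap on decorated tori -/

section Torus

variable {d L : ℕ} [NeZero L] {κ : Type*} [Fintype κ] {q : ℕ}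

/-- The ball of radius `r` about the Bravais site `x` in the decorated torus
`(ℤ/Lℤ)^d × κ`: all decorated sites `(y, k)` with `torusDist x y ≤ r` (sup-norm torus ball times
the whole unit cell). MZ13 §2 (balls `b_u(r)` of the coarse-grained lattice). [folklore] -/
def cellBall (x : TorusSite d L) (r : ℕ) : Finset (TorusSite d L × κ) :=
  torusBall x r ×ˢ univ

/-- Membership in a cell ball. MZ13 §2. [folklore] -/
@[simp] theorem mem_cellBall_iff {x : TorusSite d L} {r : ℕ} {y : TorusSite d L × κ} :
    y ∈ cellBall x r ↔ torusDist x y.1 ≤ r := by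
  simp [cellBall]

/-- Cell balls are monotone in the radius. MZ13 §2. [folklore] -/
theorem cellBall_mono (x : TorusSite d L) {r r' : ℕ} (h : r ≤ r') :
    (cellBall x r : Finset (TorusSite d L × κ)) ⊆ cellBall x r' :=
  fun _ hy => mem_cellBall_iff.2 ((mem_cellBall_iff.1 hy).trans h)

variable [DecidableEq κ]

/-- **Local topological quantum order** (MZ13 §2, Definition 2; BHM10 §2, TQO-2). The interaction
`Φ` on the decorated torus `(ℤ/Lℤ)^d × κ` has LTQO with rate `Δ : ℕ → ℝ` if for every Bravais site
`x`, radii `r, ℓ` with `2 (r + ℓ) < L` (the ball `B(x, r + ℓ)` does not wrap around the torus)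
and every observable `O` supported in `B(x, r) = cellBall x r`,
`‖P O P - c(O) P‖ ≤ ‖O‖ Δ ℓ`, where `P = P_{B(x, r+ℓ)} = localGroundProj Φ (cellBall x (r + ℓ))`,
`c(O) = tr (P O) / tr P` (`ltqoConst`) and `‖·‖` is the operator norm. [folklore] -/
def HasLTQO (Φ : Interaction (TorusSite d L × κ) q) (Δ : ℕ → ℝ) : Prop :=
  ∀ (x : TorusSite d L) (r ℓ : ℕ) (O : Op (TorusSite d L × κ) q),
    IsSupportedOn O (cellBall x r) → 2 * (r + ℓ) < L →
      ‖localGroundProj Φ (cellBall x (r + ℓ)) * O * localGroundProj Φ (cellBall x (r + ℓ)) -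
          ltqoConst (localGroundProj Φ (cellBall x (r + ℓ))) O •
            localGroundProj Φ (cellBall x (r + ℓ))‖ ≤ ‖O‖ * Δ ℓ

/-- LTQO is monotone in the rate: a larger rate function is a weaker requirement. MZ13 §2.
[folklore] -/
theorem HasLTQO.mono {Φ : Interaction (TorusSite d L × κ) q} {Δ Δ' : ℕ → ℝ} (h : HasLTQO Φ Δ)
    (hle : Δ ≤ Δ') : HasLTQO Φ Δ' :=
  fun x r ℓ O hO hL =>
    (h x r ℓ O hO hL).trans (mul_le_mul_of_nonneg_left (hle ℓ) (norm_nonneg O))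

/-- **Local gap** (MZ13 §2, Definition 3, in the cluster-gap vocabulary of outline Q-D4). The
interaction `Φ` has local gap with rate `γ : ℕ → ℝ` if for every ball `B = B(x, r)` the local
Hamiltonian `H_B = Σ_{X ⊆ B} Φ X` has an exactly `m`-fold degenerate lowest eigenvalue with a gap
`γ r > 0` above it (`Matrix.HasClusterGap H_B m 0 (γ r)`), where
`m = dim localGroundSpace Φ B`. For a frustration-free projector interaction the ground cluster
*is* the common kernel `localGroundSpace Φ B`, of energy `0`. MZ13 allow `γ r` to decay
polynomially in `r`; the uniform local gap is `γ = fun _ => γ₀`. [folklore] -/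
def HasLocalGap (Φ : Interaction (TorusSite d L × κ) q) (γ : ℕ → ℝ) : Prop :=
  ∀ (x : TorusSite d L) (r : ℕ),
    (localHamiltonian Φ (cellBall x r)).HasClusterGap
      (Module.finrank ℂ (localGroundSpace Φ (cellBall x r : Finset (TorusSite d L × κ)))) 0 (γ r)

/-- A local gap with rate `γ` may be weakened to any rate `γ'` with `0 < γ' r ≤ γ r`
(`Matrix.HasClusterGap.mono`). MZ13 §2. [folklore] -/
theorem HasLocalGap.anti {Φ : Interaction (TorusSite d L × κ) q} {γ γ' : ℕ → ℝ}
    (h : HasLocalGap Φ γ) (hpos : ∀ r, 0 < γ' r) (hle : γ' ≤ γ) : HasLocalGap Φ γ' :=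
  fun x r => (h x r).mono (hpos r) (hle r)

end Torus

/-! ### Families indexed by the side of the torus -/

section Family

variable {d : ℕ} {κ : Type*} [Fintype κ] [DecidableEq κ] {q : ℕ}

/-- **Uniform LTQO** for a family of interactions `Φ L` on the decorated tori `(ℤ/Lℤ)^d × κ`,
`L ≥ 1`: every member has LTQO with the *same* rate `Δ` (MZ13 §2, Definition 2, where `Δ(ℓ)` is
required to be independent of the system size `L`). BHM10 §2. [folklore] -/
def HasUniformLTQO (Φ : (L : ℕ) → Interaction (TorusSite d L × κ) q) (Δ : ℕ → ℝ) : Prop :=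
  ∀ (L : ℕ) [NeZero L], HasLTQO (Φ L) Δ

/-- **Uniform local gap** for a family `Φ L`, `L ≥ 1`: every member has local gap with the same
rate `γ` (MZ13 §2, Definition 3, `γ(ℓ)` independent of `L`). [folklore] -/
def HasUniformLocalGap (Φ : (L : ℕ) → Interaction (TorusSite d L × κ) q) (γ : ℕ → ℝ) : Prop :=
  ∀ (L : ℕ) [NeZero L], HasLocalGap (Φ L) γ

/-- Uniform LTQO is monotone in the rate. MZ13 §2. [folklore] -/
theorem HasUniformLTQO.mono {Φ : (L : ℕ) → Interaction (TorusSite d L × κ) q} {Δ Δ' : ℕ → ℝ}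
    (h : HasUniformLTQO Φ Δ) (hle : Δ ≤ Δ') : HasUniformLTQO Φ Δ' :=
  fun L _ => (h L).mono hle

end Family

end Literature.MathematicalPhysics.QuantumLattice
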